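import Mathlib
import Literature.MathematicalPhysics.QuantumFieldTheory.FreeTubeTransferKernel
import HarnessLib

/-!
# Tube expectations of time-slab observables are chain expectations (free tube, conditional independence)

Companion of `FreeTubeSliceAssembly.lean`, `FreeTubeTransferKernel.lean` (inline vocabulary of the route `ContractibleFibre`
of `QuantumFields/YangMills`; all objects are variables with their defining equations as hypotheses):

* `integral_mul_exp_act_eq` — for a bounded measurable tube functional `Φ` whose temporal links live in the time slab
  `D`, `∫ Φ e^{act} dν = ∫ CE_D[Φ ∘ asm](V) ∏_t K(V t, V(t+1)) dV`: the un-normalised tube expectation is the `K`-chain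
  expectation of the conditional expectation given the slices; in particular the tube partition function is the
  cyclic partition function of `K` for every time period (`integral_exp_act_eq`);
* `loc_condexp` — the conditional expectation of a `[c, c+w]`-slab observable bounded by `1` is a measurable
  `[c, c+w+1]`-slab observable of the chain bounded by `1`;
* `tube_pair_eq` — for two `[c, c+w]`-slab observables and a time shift `n > w` with `2n < T`, the un-normalised tube
  expectations `∫ F₁ (F₂ ∘ σ_n) e^{act}`, `∫ F₁ e^{act}`, `∫ (F₂ ∘ σ_n) e^{act}` are the chain expectations of
  `F̃₁ · (F̃₂ ∘ σ_n)`, `F̃₁`, `F̃₂ ∘ σ_n` (conditional independence of disjoint layer blocks, shift covariance);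
* `abs_integral_mul_exp_act_le`, `integral_exp_act_pos` — the trivial bound `|⟨Φ⟩| ≤ 1`;
* `exists_nat_log_threshold` — the period threshold `(4/m₀) log(2 + aL) + b ≤ L` for large `L`.

References: K. Osterwalder, E. Seiler, Ann. Phys. 110 (1978) 440, §2; E. Seiler, LNP 159 (1982) Ch. 2.
-/

set_option autoImplicit false

noncomputable section

open scoped BigOperators
open MeasureTheory Filter Function
open Literature.MathematicalPhysics.QuantumFieldTheory Literature.Analysis.OperatorTheory.CyclicChain

namespace Literature.MathematicalPhysics.QuantumFieldTheory.FreeTube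

/-! ### The period threshold -/

/-- **The period threshold**: for `m₀ > 0`, `a ≥ 0` and any `b`, `(4/m₀) log(2 + a L) + b ≤ L` for all large `L`
(`log x ≤ x − 1`). [folklore] -/
theorem exists_nat_log_threshold (m₀ : ℝ) (hm₀ : 0 < m₀) (a : ℝ) (ha : 0 ≤ a) (b : ℝ) :
    ∃ L₁ : ℕ, ∀ L : ℕ, L₁ ≤ L → 4 / m₀ * Real.log (2 + a * L) + b ≤ (L : ℝ) := by
  set K₀ : ℝ := 4 / m₀ * (Real.log (2 + a) - 1 - Real.log (m₀ / 8)) + b with hK₀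
  refine ⟨max 1 ⌈2 * K₀⌉₊, fun L hL => ?_⟩
  have hL1 : (1 : ℝ) ≤ L := by exact_mod_cast (le_max_left _ _).trans hL
  have hLK : 2 * K₀ ≤ L := (Nat.le_ceil _).trans (by exact_mod_cast (le_max_right _ _).trans hL)
  have h4 : 0 < 4 / m₀ := div_pos (by norm_num) hm₀
  have h2a : 0 < 2 + a := by linarith
  have hL0 : (0 : ℝ) < L := by linarith
  have hlog1 : Real.log (2 + a * L) ≤ Real.log (2 + a) + Real.log L := by
    rw [← Real.log_mul h2a.ne' hL0.ne']
    exact Real.log_le_log (by positivity) (by nlinarith)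
  have hlog2 : Real.log L ≤ m₀ / 8 * L - 1 - Real.log (m₀ / 8) := by
    have h := Real.log_le_sub_one_of_pos (show 0 < m₀ / 8 * L by positivity)
    rw [Real.log_mul (by positivity) hL0.ne'] at h
    linarith
  have h3 : 4 / m₀ * Real.log (2 + a * L) ≤ 4 / m₀ * (Real.log (2 + a) + (m₀ / 8 * L - 1 - Real.log (m₀ / 8))) :=
    mul_le_mul_of_nonneg_left (hlog1.trans (by linarith)) h4.le
  have h5 : 4 / m₀ * (Real.log (2 + a) + (m₀ / 8 * L - 1 - Real.log (m₀ / 8))) + b = L / 2 + K₀ := by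
    rw [hK₀]; field_simp; ring
  linarith

section Transfer

variable {G : Type*} [Group G] [TopologicalSpace G] [IsTopologicalGroup G] [CompactSpace G] [MeasurableSpace G]
  [BorelSpace G] [SecondCountableTopology G] {T : ℕ} {S : Type*} [Fintype S] {n : ℕ} [NeZero T]
  (ρ : G →* Matrix (Fin n) (Fin n) ℂ) (β : ℝ)
  (shS : S → Fin 3 → S) (sh : ZMod T × S → Fin 4 → ZMod T × S)
  (hsh0 : ∀ t s, sh (t, s) 0 = (t + 1, s)) (hshs : ∀ t s (j : Fin 3), sh (t, s) j.succ = (t, shS s j))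
  (ins : ZMod T × S → Fin 4 → Fin 4 → ℝ) (insS : S → Fin 4 → Fin 4 → ℝ)
  (hins : ∀ t s μ κ, ins (t, s) μ κ = insS s μ κ)
  (pl : ((ZMod T × S) × Fin 4 → G) → ZMod T × S → Fin 4 → Fin 4 → G)
  (hpl : ∀ U x μ κ, pl U x μ κ = U (x, μ) * U (sh x μ, κ) * (U (sh x κ, μ))⁻¹ * (U (x, κ))⁻¹)
  (act : ((ZMod T × S) × Fin 4 → G) → ℝ)
  (hact : ∀ U, act U = β * ∑ x, ∑ q : {q : Fin 4 × Fin 4 // q.1 < q.2},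
      ins x q.1.1 q.1.2 * (ρ (pl U x q.1.1 q.1.2)).trace.re)
  (asm : (ZMod T → S × Fin 3 → G) × (ZMod T → S → G) → (ZMod T × S) × Fin 4 → G)
  (hasm : ∀ p e, asm p e = (Fin.cons (p.2 e.1.1 e.1.2) (fun i : Fin 3 => p.1 e.1.1 (e.1.2, i)) : Fin 4 → G) e.2)
  (Ssp : (S × Fin 3 → G) → ℝ)
  (hSsp : ∀ a, Ssp a = β * ∑ s : S, ∑ i : Fin 3, ∑ j : Fin 3, if i < j then insS s i.succ j.succ *
    (ρ (a (s, i) * a (shS s i, j) * (a (shS s j, i))⁻¹ * (a (s, j))⁻¹)).trace.re else 0)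
  (Stm : (S × Fin 3 → G) → (S → G) → (S × Fin 3 → G) → ℝ)
  (hStm : ∀ a e b, Stm a e b = β * ∑ s : S, ∑ j : Fin 3, insS s 0 j.succ *
    (ρ (e s * b (s, j) * (e (shS s j))⁻¹ * (a (s, j))⁻¹)).trace.re)
  (K : (S × Fin 3 → G) → (S × Fin 3 → G) → ℝ)
  (hK : ∀ a b, K a b = Real.exp (Ssp a / 2) *
    (∫ e, Real.exp (Stm a e b) ∂(Measure.pi fun _ : S => haarProbability G)) * Real.exp (Ssp b / 2))
  (q : (S × Fin 3 → G) → (S → G) → (S × Fin 3 → G) → ℝ)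
  (hq : ∀ a e b, q a e b = Real.exp (Stm a e b) /
    ∫ e', Real.exp (Stm a e' b) ∂(Measure.pi fun _ : S => haarProbability G))

include hpl hact in
omit [CompactSpace G] in
/-- The tube Boltzmann weight is measurable. [folklore] -/
theorem measurable_exp_act (hρ : Continuous ρ) :
    Measurable fun U : (ZMod T × S) × Fin 4 → G => Real.exp (act U) :=
  (continuous_act ρ β sh ins pl hpl act hρ hact).measurable.exp

include hpl hact in
/-- The tube Boltzmann weight is integrable. [folklore] -/
theorem integrable_exp_act (hρ : Continuous ρ) :
    Integrable (fun U : (ZMod T × S) × Fin 4 → G => Real.exp (act U))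
      (Measure.pi fun _ : (ZMod T × S) × Fin 4 => haarProbability G) := by
  obtain ⟨C, hC⟩ := exists_abs_act_le ρ β sh ins pl hpl act hρ hact
  exact Integrable.of_bound (measurable_exp_act ρ β sh ins pl hpl act hact hρ).aestronglyMeasurable (Real.exp C)
    (Eventually.of_forall fun U => by
      rw [Real.norm_eq_abs, Real.abs_exp]; exact Real.exp_le_exp.2 (abs_le.1 (hC U)).2)

include hpl hact in
/-- **The tube partition function is positive.** [folklore] -/
theorem integral_exp_act_pos (hρ : Continuous ρ) :
    0 < ∫ U, Real.exp (act U) ∂(Measure.pi fun _ : (ZMod T × S) × Fin 4 => haarProbability G) :=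
  integral_exp_pos (integrable_exp_act ρ β sh ins pl hpl act hact hρ)

include hpl hact in
/-- `|∫ Φ e^{act}| ≤ ∫ e^{act}` for `|Φ| ≤ 1` (so that the normalised tube expectation of `Φ` is bounded by `1`).
[folklore] -/
theorem abs_integral_mul_exp_act_le (hρ : Continuous ρ) (Φ : ((ZMod T × S) × Fin 4 → G) → ℝ)
    (hΦ1 : ∀ U, |Φ U| ≤ 1) :
    |∫ U, Φ U * Real.exp (act U) ∂(Measure.pi fun _ : (ZMod T × S) × Fin 4 => haarProbability G)| ≤
      ∫ U, Real.exp (act U) ∂(Measure.pi fun _ : (ZMod T × S) × Fin 4 => haarProbability G) := by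
  have h := norm_integral_le_of_norm_le (integrable_exp_act ρ β sh ins pl hpl act hact hρ)
    (Eventually.of_forall fun U => show ‖Φ U * Real.exp (act U)‖ ≤ Real.exp (act U) by
      rw [norm_mul, Real.norm_eq_abs, Real.norm_eq_abs, Real.abs_exp]
      exact mul_le_of_le_one_left (Real.exp_pos _).le (hΦ1 U))
  rwa [Real.norm_eq_abs] at h

include hsh0 hshs hins hpl hact hasm hSsp hStm hK hq in
/-- **Un-normalised tube expectations are chain expectations of conditional expectations.**  For a bounded measurable
tube functional `Φ` whose dependence on the temporal links is confined to the time slab `D`,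
`∫ Φ e^{act} dν = ∫ CE_D[Φ ∘ asm](V) ∏_t K(V t, V(t+1)) dV` with
`CE_D[Ψ](V) = ∫ Ψ(V, E) ∏_{t ∈ D} q(V t, E t, V(t+1)) dE` (assembling is measure preserving, the action splits over
slabs, `integral_mul_exp_sum_eq`). [cite: OsterwalderSeiler1978, §2] -/
theorem integral_mul_exp_act_eq (hρ : Continuous ρ) (Φ : ((ZMod T × S) × Fin 4 → G) → ℝ) (hΦ : Measurable Φ)
    {BΦ : ℝ} (hΦB : ∀ U, |Φ U| ≤ BΦ) (D : Finset (ZMod T))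
    (hΦD : ∀ V E E', (∀ t ∈ D, E t = E' t) → Φ (asm (V, E)) = Φ (asm (V, E'))) :
    ∫ U, Φ U * Real.exp (act U) ∂(Measure.pi fun _ : (ZMod T × S) × Fin 4 => haarProbability G) =
      ∫ V, (∫ E, Φ (asm (V, E)) * ∏ t ∈ D, q (V t) (E t) (V (t + 1))
          ∂(Measure.pi fun _ : ZMod T => Measure.pi fun _ : S => haarProbability G)) * ∏ t, K (V t) (V (t + 1))
        ∂(Measure.pi fun _ : ZMod T => Measure.pi fun _ : S × Fin 3 => haarProbability G) := by
  obtain ⟨B₁, hB₁⟩ := exists_abs_Ssp_le ρ β shS insS Ssp hSsp hρ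
  obtain ⟨B₂, hB₂⟩ := exists_abs_Stm_le ρ β shS insS Stm hStm hρ
  rw [integral_comp_asm asm hasm (fun U => Φ U * Real.exp (act U))
    (hΦ.mul (measurable_exp_act ρ β sh ins pl hpl act hact hρ))]
  simp_rw [act_asm ρ β shS sh hsh0 hshs ins insS hins pl hpl act asm hasm Ssp hSsp Stm hStm hact]
  exact integral_mul_exp_sum_eq (Measure.pi fun _ : S × Fin 3 => haarProbability G)
    (Measure.pi fun _ : S => haarProbability G) Ssp Stm K q
    (measurable_Ssp ρ β shS insS Ssp hSsp hρ) (measurable_Stm ρ β shS insS Stm hStm hρ) (B := max B₁ B₂)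
    (fun a => (le_abs_self _).trans ((hB₁ a).trans (le_max_left _ _)))
    (fun a e b => (le_abs_self _).trans ((hB₂ a e b).trans (le_max_right _ _))) hK hq
    (fun p => Φ (asm p)) (hΦ.comp (measurable_asm asm hasm)) (fun p => hΦB _) D (fun V E E' h => hΦD V E E' h)

include hsh0 hshs hins hpl hact hasm hSsp hStm hK hq in
/-- **The tube partition function is the cyclic partition function of the slice kernel** (any time period `T`):
`∫ e^{act} dν = ∫ ∏_{t ∈ ℤ_T} K(V t, V(t+1)) dV`. [cite: OsterwalderSeiler1978, §2] -/
theorem integral_exp_act_eq (hρ : Continuous ρ) :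
    ∫ U, Real.exp (act U) ∂(Measure.pi fun _ : (ZMod T × S) × Fin 4 => haarProbability G) =
      ∫ V, ∏ t, K (V t) (V (t + 1)) ∂(Measure.pi fun _ : ZMod T => Measure.pi fun _ : S × Fin 3 => haarProbability G) := by
  have h := integral_mul_exp_act_eq ρ β shS sh hsh0 hshs ins insS hins pl hpl act hact asm hasm Ssp hSsp Stm hStm
    K hK q hq hρ (fun _ => (1 : ℝ)) measurable_const (BΦ := 1) (fun _ => by simp) ∅ (fun _ _ _ _ => rfl)
  simp only [one_mul, Finset.prod_empty, mul_one, integral_const, smul_eq_mul, probReal_univ] at h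
  exact h

include hStm hasm hq in
/-- **The conditional expectation of a slab observable is a slab observable of the chain.**  If `F` is measurable,
bounded by `1` and depends on the links based in the time slab `[c, c+w]` only, then
`F̃(V) = CE_{[c,c+w]}[F ∘ asm](V)` is measurable, bounded by `1`, and depends on the slices `V t`, `t ∈ [c, c+w+1]`
only. [folklore] -/
theorem loc_condexp (hρ : Continuous ρ) (c : ZMod T) (w : ℕ) (F : ((ZMod T × S) × Fin 4 → G) → ℝ)
    (hFm : Measurable F) (hF1 : ∀ U, |F U| ≤ 1)
    (hFl : ∀ U U', (∀ p : (ZMod T × S) × Fin 4, (p.1.1 - c).val ≤ w → U p = U' p) → F U = F U')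
    (Ft : (ZMod T → S × Fin 3 → G) → ℝ)
    (hFt : ∀ V, Ft V = ∫ E, F (asm (V, E)) * ∏ t ∈ Finset.univ.filter (fun t : ZMod T => (t - c).val ≤ w),
      q (V t) (E t) (V (t + 1)) ∂(Measure.pi fun _ : ZMod T => Measure.pi fun _ : S => haarProbability G)) :
    Measurable Ft ∧ (∀ V, |Ft V| ≤ 1) ∧
      ∀ V V', (∀ t : ZMod T, (t - c).val ≤ w + 1 → V t = V' t) → Ft V = Ft V' := by
  obtain ⟨B₂, hB₂⟩ := exists_abs_Stm_le ρ β shS insS Stm hStm hρ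
  have hStmm := measurable_Stm ρ β shS insS Stm hStm hρ
  have hStmB : ∀ a e b, Stm a e b ≤ B₂ := fun a e b => (le_abs_self _).trans (hB₂ a e b)
  have hFt' : Ft = fun V => ∫ E, F (asm (V, E)) * ∏ t ∈ Finset.univ.filter (fun t : ZMod T => (t - c).val ≤ w),
      q (V t) (E t) (V (t + 1)) ∂(Measure.pi fun _ : ZMod T => Measure.pi fun _ : S => haarProbability G) :=
    funext hFt
  refine ⟨?_, fun V => ?_, fun V V' hVV' => ?_⟩
  · rw [hFt']
    exact measurable_condexp _ Stm q hStmm hq (fun p => F (asm p)) (hFm.comp (measurable_asm asm hasm)) _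
  · rw [hFt]
    exact abs_condexp_le_one _ Stm q hStmm hStmB hq (fun p => F (asm p)) (fun p => hF1 _) _ V
  · rw [hFt, hFt]
    refine condexp_congr_of_eqOn _ q (fun p => F (asm p)) _ {t : ZMod T | (t - c).val ≤ w + 1}
      (fun t ht => ?_) (fun V₁ V₂ E h => ?_) V V' fun t ht => hVV' t ht
    · simp only [Finset.mem_filter, Finset.mem_univ, true_and] at ht
      refine ⟨Nat.le_succ_of_le ht, ?_⟩
      show (t + 1 - c).val ≤ w + 1
      rw [add_sub_right_comm]
      refine (ZMod.val_add_le _ _).trans (add_le_add ht ?_)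
      rw [ZMod.val_one_eq_one_mod]
      exact Nat.mod_le 1 T
    · exact apply_asm_eq_of_eqOn asm hasm F {t : ZMod T | (t - c).val ≤ w} (fun U U' hUU' => hFl U U' hUU')
        V₁ V₂ E E (fun t ht => h t (Nat.le_succ_of_le ht)) fun _ _ => rfl

include hsh0 hshs hins hpl hact hasm hSsp hStm hK hq in
/-- **Tube covariances of slab observables are chain covariances.**  For two `[c, c+w]`-slab observables `F₁, F₂`
(measurable, bounded by `1`), a time shift `n > w` with `2n < T`, and their conditional expectations
`F̃ᵢ = CE_{[c,c+w]}[Fᵢ ∘ asm]`: `∫ F₁ (F₂ ∘ σ_n) e^{act} = ∫ F̃₁(V) F̃₂(σ_n V) ∏ K`, `∫ F₁ e^{act} = ∫ F̃₁ ∏ K` and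
`∫ (F₂ ∘ σ_n) e^{act} = ∫ F̃₂(σ_n V) ∏ K` — the temporal links of `F₁` and of `F₂ ∘ σ_n` live in the disjoint slabs
`[c, c+w]`, `[c+n, c+n+w]`, which are conditionally independent given the slices, and the conditional expectation is
shift covariant. [cite: OsterwalderSeiler1978, §2] -/
theorem tube_pair_eq (hρ : Continuous ρ)
    (σ : ℕ → ((ZMod T × S) × Fin 4 → G) → (ZMod T × S) × Fin 4 → G) (hσ : ∀ n U p, σ n U p = U ((p.1.1 + n, p.1.2), p.2))
    (c : ZMod T) (w m : ℕ) (hwm : w < m) (h2m : 2 * m < T) (F₁ F₂ : ((ZMod T × S) × Fin 4 → G) → ℝ)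
    (hF₁m : Measurable F₁) (hF₂m : Measurable F₂) (hF₁b : ∀ U, |F₁ U| ≤ 1) (hF₂b : ∀ U, |F₂ U| ≤ 1)
    (hF₁l : ∀ U U', (∀ p : (ZMod T × S) × Fin 4, (p.1.1 - c).val ≤ w → U p = U' p) → F₁ U = F₁ U')
    (hF₂l : ∀ U U', (∀ p : (ZMod T × S) × Fin 4, (p.1.1 - c).val ≤ w → U p = U' p) → F₂ U = F₂ U')
    (Ft₁ Ft₂ : (ZMod T → S × Fin 3 → G) → ℝ)
    (hFt₁ : ∀ V, Ft₁ V = ∫ E, F₁ (asm (V, E)) * ∏ t ∈ Finset.univ.filter (fun t : ZMod T => (t - c).val ≤ w),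
      q (V t) (E t) (V (t + 1)) ∂(Measure.pi fun _ : ZMod T => Measure.pi fun _ : S => haarProbability G))
    (hFt₂ : ∀ V, Ft₂ V = ∫ E, F₂ (asm (V, E)) * ∏ t ∈ Finset.univ.filter (fun t : ZMod T => (t - c).val ≤ w),
      q (V t) (E t) (V (t + 1)) ∂(Measure.pi fun _ : ZMod T => Measure.pi fun _ : S => haarProbability G)) :
    (∫ U, F₁ U * F₂ (σ m U) * Real.exp (act U) ∂(Measure.pi fun _ : (ZMod T × S) × Fin 4 => haarProbability G) =
      ∫ V, Ft₁ V * Ft₂ (fun t => V (t + m)) * ∏ t, K (V t) (V (t + 1))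
        ∂(Measure.pi fun _ : ZMod T => Measure.pi fun _ : S × Fin 3 => haarProbability G)) ∧
    (∫ U, F₁ U * Real.exp (act U) ∂(Measure.pi fun _ : (ZMod T × S) × Fin 4 => haarProbability G) =
      ∫ V, Ft₁ V * ∏ t, K (V t) (V (t + 1))
        ∂(Measure.pi fun _ : ZMod T => Measure.pi fun _ : S × Fin 3 => haarProbability G)) ∧
    (∫ U, F₂ (σ m U) * Real.exp (act U) ∂(Measure.pi fun _ : (ZMod T × S) × Fin 4 => haarProbability G) =
      ∫ V, Ft₂ (fun t => V (t + m)) * ∏ t, K (V t) (V (t + 1))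
        ∂(Measure.pi fun _ : ZMod T => Measure.pi fun _ : S × Fin 3 => haarProbability G)) := by
  classical
  set μE : Measure (ZMod T → S → G) := Measure.pi fun _ : ZMod T => Measure.pi fun _ : S => haarProbability G
    with hμE
  -- the two temporal slabs
  set A : Finset (ZMod T) := Finset.univ.filter (fun t : ZMod T => (t - c).val ≤ w) with hA
  set B : Finset (ZMod T) := A.image (fun t => t + (m : ZMod T)) with hB
  have hmval : ((m : ℕ) : ZMod T).val = m := ZMod.val_cast_of_lt (by omega)
  have hAB : Disjoint A B := by
    rw [Finset.disjoint_left]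
    rintro t htA htB
    obtain ⟨u, huA, rfl⟩ := Finset.mem_image.1 htB
    simp only [hA, Finset.mem_filter, Finset.mem_univ, true_and] at htA huA
    have hlt : (u - c).val + ((m : ℕ) : ZMod T).val < T := by rw [hmval]; omega
    have hval : (u + (m : ZMod T) - c).val = (u - c).val + m := by
      rw [add_sub_right_comm, ZMod.val_add_of_lt hlt, hmval]
    omega
  -- locality of the two observables read through the assembling map
  have hmem : ∀ t : ZMod T, t ∈ A ↔ (t - c).val ≤ w := fun t => by simp [hA]
  have hΦ₁D : ∀ V E E', (∀ t ∈ A, E t = E' t) → F₁ (asm (V, E)) = F₁ (asm (V, E')) := fun V E E' h =>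
    apply_asm_eq_of_eqOn asm hasm F₁ {t : ZMod T | (t - c).val ≤ w} (fun U U' hUU' => hF₁l U U' hUU') V V E E'
      (fun _ _ => rfl) fun t ht => h t ((hmem t).2 ht)
  have hΨ₂D : ∀ V E E', (∀ t ∈ A, E t = E' t) → F₂ (asm (V, E)) = F₂ (asm (V, E')) := fun V E E' h =>
    apply_asm_eq_of_eqOn asm hasm F₂ {t : ZMod T | (t - c).val ≤ w} (fun U U' hUU' => hF₂l U U' hUU') V V E E'
      (fun _ _ => rfl) fun t ht => h t ((hmem t).2 ht)
  have hshift : ∀ (V : ZMod T → S × Fin 3 → G) (E : ZMod T → S → G),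
      σ m (asm (V, E)) = asm (fun t => V (t + m), fun t => E (t + m)) := shift_asm asm hasm σ hσ m
  have hΦ₂D : ∀ V E E', (∀ t ∈ B, E t = E' t) → F₂ (σ m (asm (V, E))) = F₂ (σ m (asm (V, E'))) := by
    intro V E E' h
    rw [hshift, hshift]
    exact hΨ₂D _ _ _ fun t ht => h (t + m) (Finset.mem_image_of_mem _ ht)
  have hσm : Measurable (σ m) := by
    have h : σ m = fun U p => U ((p.1.1 + m, p.1.2), p.2) := funext fun U => funext fun p => hσ m U p
    rw [h]
    exact measurable_pi_lambda _ fun p => measurable_pi_apply _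
  -- the conditional expectation of the shifted observable
  have hCE₂ : ∀ V : ZMod T → S × Fin 3 → G,
      ∫ E, F₂ (σ m (asm (V, E))) * ∏ t ∈ B, q (V t) (E t) (V (t + 1)) ∂μE = Ft₂ fun t => V (t + m) := by
    intro V
    rw [hFt₂]
    simp_rw [hshift]
    have h2 := condexp_shift (Measure.pi fun _ : S => haarProbability G) q (fun p => F₂ (asm p)) A (m : ZMod T) V
    simp only [] at h2
    rw [hB, h2]
    refine integral_congr_ae (Eventually.of_forall fun E => ?_)
    dsimp only
    congr 1
    exact Finset.prod_congr rfl fun t _ => by rw [add_right_comm]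
  refine ⟨?_, ?_, ?_⟩
  · rw [integral_mul_exp_act_eq ρ β shS sh hsh0 hshs ins insS hins pl hpl act hact asm hasm Ssp hSsp Stm hStm K hK
      q hq hρ (fun U => F₁ U * F₂ (σ m U)) (hF₁m.mul (hF₂m.comp hσm)) (BΦ := 1)
      (fun U => by rw [abs_mul]; exact mul_le_one₀ (hF₁b U) (abs_nonneg _) (hF₂b _)) (A ∪ B)
      (fun V E E' h => by
        rw [hΦ₁D V E E' fun t ht => h t (Finset.mem_union_left _ ht),
          hΦ₂D V E E' fun t ht => h t (Finset.mem_union_right _ ht)])]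
    refine integral_congr_ae (Eventually.of_forall fun V => ?_)
    dsimp only
    congr 1
    have h1 := condexp_mul_eq (Measure.pi fun _ : S => haarProbability G) q (fun p => F₁ (asm p))
      (fun p => F₂ (σ m (asm p))) A B hAB hΦ₁D hΦ₂D V
    simp only [] at h1
    rw [h1, hCE₂ V, hFt₁]
  · rw [integral_mul_exp_act_eq ρ β shS sh hsh0 hshs ins insS hins pl hpl act hact asm hasm Ssp hSsp Stm hStm K hK
      q hq hρ F₁ hF₁m (hF₁b) A hΦ₁D]
    refine integral_congr_ae (Eventually.of_forall fun V => ?_)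
    dsimp only
    rw [hFt₁]
  · rw [integral_mul_exp_act_eq ρ β shS sh hsh0 hshs ins insS hins pl hpl act hact asm hasm Ssp hSsp Stm hStm K hK
      q hq hρ (fun U => F₂ (σ m U)) (hF₂m.comp hσm) (fun U => hF₂b _) B hΦ₂D]
    refine integral_congr_ae (Eventually.of_forall fun V => ?_)
    dsimp only
    rw [hCE₂ V]

end Transfer

end Literature.MathematicalPhysics.QuantumFieldTheory.FreeTube

end
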